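import Summits.Ventures.HodgeRepro2.T5SU11ResolventL2SchurWeighted
import Summits.Ventures.HodgeRepro2.T5SU11ResolventNeumann

/-!
# The weighted sup-norm theory of the resolvent for every `λ > 1`: the weight `φ_{λ′}`, `1 < λ′ < λ`

Rows 542–543 control the resolvent in the sup-norm for `λ > 2` only (for `λ ≤ 2` the constant source is not even in the
domain, S4.112). With the spherical weight `φ_{λ′}`, `1 < λ′ < λ`, the sup-norm theory extends to **every `λ > 1`**:
writing `‖g‖_{λ′} := sup_{t > 0} |g(t)|/φ_{λ′}(t)` and `μ − μ′ = λ(λ − 2) − λ′(λ′ − 2) > 0`, for a source of the class with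
`|g| ≤ D φ_{λ′}` on `(0, ∞)`,

* `abs_greenSolI_le_mul_sph` — **`|G^I_λ g(t)| ≤ D φ_{λ′}(t)/(μ − μ′)`**, i.e. `‖G^I_λ‖_{λ′ → λ′} ≤ 1/(μ − μ′)` (row 548's
  weighted row sums `∫ |K_λ(t, s)| φ_{λ′}(s) sinh 2s ds = φ_{λ′}(t)/(μ − μ′)`);
* `abs_iterate_le_mul_sph` — **`|(G^I_λ)ⁿ g(t)| ≤ D φ_{λ′}(t)/(μ − μ′)ⁿ`** (row 503's class data of the iterates);
* `abs_greenSolI_sub_le_mul_sph` — **`|G^I_λ g(t) − G^I_{λ₂} g(t)| ≤ |μ − μ₂| D φ_{λ′}(t)/((μ − μ′)(μ₂ − μ′))`** for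
  `λ, λ₂ > λ′` (row 500's resolvent identity);
* `abs_neumann_remainder_le_mul_sph`, `tendsto_neumann_weighted` — **the Neumann series
  `Σ (μ − μ₂)^k (G^I_{λ₂})^{k+1} g` converges to `G^I_λ g` in the weighted sup-norm for `|μ − μ₂| < μ₂ − μ′`**, with the
  remainder `≤ (|μ − μ₂|/(μ₂ − μ′))^{n+1} D φ_{λ′}(t)/(μ − μ′)` — the disc `|μ − μ₂| < dist(μ₂, μ′)`, which as `λ′ → 1⁺`
  becomes row 540's `L²` disc `|μ − μ₂| < (λ₂ − 1)²`.

Nothing is claimed about (N).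

Blind lane: Mathlib + the HodgeRepro2 prefix only; no sorry; axioms ⊆ {propext, Classical.choice,
Quot.sound}.
-/

namespace Summit.Ventures.HodgeRepro2.T5SU11ResolventSupNormWeighted

open Filter Topology MeasureTheory
open Set (Ioi Ioc)
open T5SU11Cartan T5SU11SphericalFunction T5SU11SphericalDecay T5SU11RadialGreenKernel
  T5SU11RadialGreenImproper T5SU11RadialGreenImproperDecaySource T5SU11RadialGreenImproperStable
  T5SU11ResolventKernelComposition T5SU11ResolventTransformClass T5SU11ResolventIdentityDecay
  T5SU11ResolventNeumann T5SU11SphericalBounds T5SU11ResolventL2SchurWeighted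

section measure

variable [MeasurableSpace Circle] [BorelSpace Circle]

variable {lam lam' : ℝ} (hlam : 1 < lam) (h1 : 1 < lam') (h2 : lam' < lam)

include hlam h1 h2 in
/-- **THE WEIGHTED `L^∞` BOUND OF THE RESOLVENT**: for a source `g` of the class with `|g| ≤ D φ_{λ′}` on `(0, ∞)`,
`|G^I_λ g(t)| ≤ D φ_{λ′}(t)/(μ − μ′)` for every `t > 0` (`1 < λ′ < λ`). -/
theorem abs_greenSolI_le_mul_sph {g : ℝ → ℝ} (hg : ContinuousOn g (Ioi 0))
    {M : ℝ} (hM : ∀ s ∈ Ioc (0 : ℝ) 1, |g s| ≤ M) (hM0 : 0 ≤ M)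
    {ε C s₀ : ℝ} (hε : 2 - lam < ε) (hC : ∀ s, s₀ ≤ s → |g s| ≤ C * Real.exp (-ε * s))
    {D : ℝ} (hD : ∀ s, 0 < s → |g s| ≤ D * sph lam' (hyp s)) {t : ℝ} (ht : 0 < t) :
    |greenSolI (fun t => sph lam (hyp t)) (sphDecay lam) g t|
      ≤ D * sph lam' (hyp t) / (lam * (lam - 2) - lam' * (lam' - 2)) := by
  have hB := integrableOn_sph_mul_mul_sinh_Ioc hg hM hM0 lam
  have hA := integrableOn_sphDecay_mul_mul_sinh hlam hg hM hM0 hε hC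
  have hI1 : IntegrableOn (fun s => |sphGreenKernel lam t s * g s * Real.sinh (2 * s)|) (Ioi 0) :=
    (integrableOn_kernel_mul hB hA ht).abs
  have hI2 : IntegrableOn (fun s => D * (|sphGreenKernel lam t s| * sph lam' (hyp s) * Real.sinh (2 * s))) (Ioi 0) :=
    (integrableOn_abs_sphGreenKernel_mul_sph_snd hlam h1 h2 ht).const_mul D
  rw [greenSolI_eq_integral_kernel hB hA ht]
  change |∫ s in Ioi 0, sphGreenKernel lam t s * g s * Real.sinh (2 * s)| ≤ _
  calc |∫ s in Ioi 0, sphGreenKernel lam t s * g s * Real.sinh (2 * s)|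
      ≤ ∫ s in Ioi 0, |sphGreenKernel lam t s * g s * Real.sinh (2 * s)| := by
        have := norm_integral_le_integral_norm (μ := volume.restrict (Ioi 0))
          (fun s => sphGreenKernel lam t s * g s * Real.sinh (2 * s))
        simpa only [Real.norm_eq_abs] using this
    _ ≤ ∫ s in Ioi 0, D * (|sphGreenKernel lam t s| * sph lam' (hyp s) * Real.sinh (2 * s)) := by
        refine setIntegral_mono_on hI1 hI2 measurableSet_Ioi (fun s hs => ?_)
        have hs0 : 0 < s := hs
        have hsinh : 0 ≤ Real.sinh (2 * s) := Real.sinh_nonneg_iff.mpr (by linarith)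
        rw [abs_mul, abs_mul, abs_of_nonneg hsinh]
        calc |sphGreenKernel lam t s| * |g s| * Real.sinh (2 * s)
            ≤ |sphGreenKernel lam t s| * (D * sph lam' (hyp s)) * Real.sinh (2 * s) :=
              mul_le_mul_of_nonneg_right (mul_le_mul_of_nonneg_left (hD s hs0) (abs_nonneg _)) hsinh
          _ = D * (|sphGreenKernel lam t s| * sph lam' (hyp s) * Real.sinh (2 * s)) := by ring
    _ = D * sph lam' (hyp t) / (lam * (lam - 2) - lam' * (lam' - 2)) := by
        rw [MeasureTheory.integral_const_mul, integral_abs_sphGreenKernel_mul_sph_snd hlam h1 h2 ht]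
        ring

include hlam h1 h2 in
/-- **The iterates in the weighted sup-norm**: `|(G^I_λ)ⁿ g(t)| ≤ D φ_{λ′}(t)/(μ − μ′)ⁿ` for every `n` and `t > 0`. -/
theorem abs_iterate_le_mul_sph {g : ℝ → ℝ} (hg : ContinuousOn g (Ioi 0))
    {M : ℝ} (hM : ∀ s ∈ Ioc (0 : ℝ) 1, |g s| ≤ M) (hM0 : 0 ≤ M)
    {ε C s₀ : ℝ} (hε : 2 - lam < ε) (hC : ∀ s, s₀ ≤ s → |g s| ≤ C * Real.exp (-ε * s))
    {D : ℝ} (hD : ∀ s, 0 < s → |g s| ≤ D * sph lam' (hyp s)) (n : ℕ) :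
    ∀ t, 0 < t → |((greenSolI (fun t => sph lam (hyp t)) (sphDecay lam))^[n] g) t|
      ≤ D * sph lam' (hyp t) / (lam * (lam - 2) - lam' * (lam' - 2)) ^ n := by
  induction n with
  | zero => intro t ht; simpa using hD t ht
  | succ n ih =>
    intro t ht
    obtain ⟨hcont, ⟨M', hM'0, hM'⟩, hrate⟩ := iterate_class (lam₂ := lam) hlam hg hM hM0 hε hC n
    have hmin : 2 - lam < min ε lam := lt_min hε (by linarith)
    obtain ⟨K, T, hK0, hT, hKT⟩ := hrate ((2 - lam + min ε lam) / 2) (by linarith)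
    have hDn : ∀ s, 0 < s → |((greenSolI (fun t => sph lam (hyp t)) (sphDecay lam))^[n] g) s|
        ≤ (D / (lam * (lam - 2) - lam' * (lam' - 2)) ^ n) * sph lam' (hyp s) := by
      intro s hs
      rw [div_mul_eq_mul_div]
      exact ih s hs
    rw [Function.iterate_succ_apply']
    have hstep := abs_greenSolI_le_mul_sph hlam h1 h2 hcont hM' hM'0 (by linarith : 2 - lam < (2 - lam + min ε lam) / 2)
      hKT hDn ht
    calc |greenSolI (fun t => sph lam (hyp t)) (sphDecay lam)
          ((greenSolI (fun t => sph lam (hyp t)) (sphDecay lam))^[n] g) t|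
        ≤ (D / (lam * (lam - 2) - lam' * (lam' - 2)) ^ n) * sph lam' (hyp t)
            / (lam * (lam - 2) - lam' * (lam' - 2)) := hstep
      _ = D * sph lam' (hyp t) / (lam * (lam - 2) - lam' * (lam' - 2)) ^ (n + 1) := by
          rw [pow_succ, div_mul_eq_mul_div, div_div]

include h1 in
/-- **The resolvent is Lipschitz in `μ` in the weighted sup-norm**:
`|G^I_λ g(t) − G^I_{λ₂} g(t)| ≤ |μ − μ₂| D φ_{λ′}(t)/((μ − μ′)(μ₂ − μ′))` for `λ, λ₂ > λ′` and a source of the class (rate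
`ε > max(2 − λ, 2 − λ₂)`) with `|g| ≤ D φ_{λ′}`. -/
theorem abs_greenSolI_sub_le_mul_sph {lam₂ : ℝ} (h2 : lam' < lam) (h2' : lam' < lam₂)
    {g : ℝ → ℝ} (hg : ContinuousOn g (Ioi 0))
    {M : ℝ} (hM : ∀ s ∈ Ioc (0 : ℝ) 1, |g s| ≤ M) (hM0 : 0 ≤ M)
    {ε C s₀ : ℝ} (hε : 2 - lam < ε) (hε₂ : 2 - lam₂ < ε) (hC : ∀ s, s₀ ≤ s → |g s| ≤ C * Real.exp (-ε * s))
    {D : ℝ} (hD : ∀ s, 0 < s → |g s| ≤ D * sph lam' (hyp s)) {t : ℝ} (ht : 0 < t) :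
    |greenSolI (fun t => sph lam (hyp t)) (sphDecay lam) g t - greenSolI (fun t => sph lam₂ (hyp t)) (sphDecay lam₂) g t|
      ≤ |lam * (lam - 2) - lam₂ * (lam₂ - 2)| * D * sph lam' (hyp t)
        / ((lam * (lam - 2) - lam' * (lam' - 2)) * (lam₂ * (lam₂ - 2) - lam' * (lam' - 2))) := by
  have hlam : 1 < lam := by linarith
  have hlam₂ : 1 < lam₂ := by linarith
  have hμ : 0 < lam * (lam - 2) - lam' * (lam' - 2) := by nlinarith
  have hμ₂ : 0 < lam₂ * (lam₂ - 2) - lam' * (lam' - 2) := by nlinarith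
  rw [greenSolI_sub_greenSolI_eq hlam hlam₂ hg hM hM0 hε hε₂ hC ht, abs_mul]
  -- the class data of `G^I_{λ₂} g` (row 499) and its weighted bound
  have hcont := continuousOn_greenSolI hlam₂ hg hM hM0 hε₂ hC
  obtain ⟨M', hM'0, hM'⟩ := exists_abs_greenSolI_le_of_le_one hlam₂ hg hM hM0 hε₂ hC
  have hmin : 2 - lam < min ε lam₂ := lt_min hε (by linarith)
  obtain ⟨K, T, hK0, hT, hKT⟩ := exists_abs_greenSolI_le_exp hlam₂ hg hM hM0 hε₂ hC
    (ε' := (2 - lam + min ε lam₂) / 2) (by linarith)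
  have hD₂ : ∀ s, 0 < s → |greenSolI (fun t => sph lam₂ (hyp t)) (sphDecay lam₂) g s|
      ≤ (D / (lam₂ * (lam₂ - 2) - lam' * (lam' - 2))) * sph lam' (hyp s) := by
    intro s hs
    rw [div_mul_eq_mul_div]
    exact abs_greenSolI_le_mul_sph hlam₂ h1 h2' hg hM hM0 hε₂ hC hD hs
  have hstep := abs_greenSolI_le_mul_sph hlam h1 h2 hcont hM' hM'0 (by linarith : 2 - lam < (2 - lam + min ε lam₂) / 2)
    hKT hD₂ ht
  calc |lam * (lam - 2) - lam₂ * (lam₂ - 2)|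
        * |greenSolI (fun t => sph lam (hyp t)) (sphDecay lam) (greenSolI (fun t => sph lam₂ (hyp t)) (sphDecay lam₂) g) t|
      ≤ |lam * (lam - 2) - lam₂ * (lam₂ - 2)| * ((D / (lam₂ * (lam₂ - 2) - lam' * (lam' - 2))) * sph lam' (hyp t)
          / (lam * (lam - 2) - lam' * (lam' - 2))) := mul_le_mul_of_nonneg_left hstep (abs_nonneg _)
    _ = |lam * (lam - 2) - lam₂ * (lam₂ - 2)| * D * sph lam' (hyp t)
          / ((lam * (lam - 2) - lam' * (lam' - 2)) * (lam₂ * (lam₂ - 2) - lam' * (lam' - 2))) := by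
        field_simp

include h1 in
/-- **The remainder of the Neumann series in the weighted sup-norm**:
`|G^I_λ g(t) − Σ_{k ≤ n} (μ − μ₂)^k (G^I_{λ₂})^{k+1} g(t)| ≤ (|μ − μ₂|/(μ₂ − μ′))^{n+1} D φ_{λ′}(t)/(μ − μ′)` for
`λ, λ₂ > λ′` and a source of the class with `|g| ≤ D φ_{λ′}`. -/
theorem abs_neumann_remainder_le_mul_sph {lam₂ : ℝ} (h2 : lam' < lam) (h2' : lam' < lam₂)
    {g : ℝ → ℝ} (hg : ContinuousOn g (Ioi 0))
    {M : ℝ} (hM : ∀ s ∈ Ioc (0 : ℝ) 1, |g s| ≤ M) (hM0 : 0 ≤ M)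
    {ε C s₀ : ℝ} (hε : 2 - lam < ε) (hε₂ : 2 - lam₂ < ε) (hC : ∀ s, s₀ ≤ s → |g s| ≤ C * Real.exp (-ε * s))
    {D : ℝ} (hD : ∀ s, 0 < s → |g s| ≤ D * sph lam' (hyp s)) (n : ℕ) {t : ℝ} (ht : 0 < t) :
    |greenSolI (fun t => sph lam (hyp t)) (sphDecay lam) g t
        - ∑ k ∈ Finset.range (n + 1), (lam * (lam - 2) - lam₂ * (lam₂ - 2)) ^ k
          * (greenSolI (fun t => sph lam₂ (hyp t)) (sphDecay lam₂))^[k + 1] g t|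
      ≤ (|lam * (lam - 2) - lam₂ * (lam₂ - 2)| / (lam₂ * (lam₂ - 2) - lam' * (lam' - 2))) ^ (n + 1)
        * (D * sph lam' (hyp t) / (lam * (lam - 2) - lam' * (lam' - 2))) := by
  have hlam : 1 < lam := by linarith
  have hlam₂ : 1 < lam₂ := by linarith
  have hμ : 0 < lam * (lam - 2) - lam' * (lam' - 2) := by nlinarith
  have hμ₂ : 0 < lam₂ * (lam₂ - 2) - lam' * (lam' - 2) := by nlinarith
  rw [neumann_finite hlam hlam₂ hg hM hM0 hε hε₂ hC n ht, add_sub_cancel_left, abs_mul, abs_pow]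
  -- the class data of `(G^I_{λ₂})^{n+1} g` (row 503) and its weighted bound (the iterates)
  obtain ⟨hcont, ⟨M', hM'0, hM'⟩, hrate⟩ := iterate_class (lam₂ := lam₂) hlam₂ hg hM hM0 hε₂ hC (n + 1)
  have hmin : 2 - lam < min ε lam₂ := lt_min hε (by linarith)
  obtain ⟨K, T, hK0, hT, hKT⟩ := hrate ((2 - lam + min ε lam₂) / 2) (by linarith)
  have hDn : ∀ s, 0 < s → |((greenSolI (fun t => sph lam₂ (hyp t)) (sphDecay lam₂))^[n + 1] g) s|
      ≤ (D / (lam₂ * (lam₂ - 2) - lam' * (lam' - 2)) ^ (n + 1)) * sph lam' (hyp s) := by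
    intro s hs
    rw [div_mul_eq_mul_div]
    exact abs_iterate_le_mul_sph hlam₂ h1 h2' hg hM hM0 hε₂ hC hD (n + 1) s hs
  have hstep := abs_greenSolI_le_mul_sph hlam h1 h2 hcont hM' hM'0 (by linarith : 2 - lam < (2 - lam + min ε lam₂) / 2)
    hKT hDn ht
  calc |lam * (lam - 2) - lam₂ * (lam₂ - 2)| ^ (n + 1)
        * |greenSolI (fun t => sph lam (hyp t)) (sphDecay lam)
          ((greenSolI (fun t => sph lam₂ (hyp t)) (sphDecay lam₂))^[n + 1] g) t|
      ≤ |lam * (lam - 2) - lam₂ * (lam₂ - 2)| ^ (n + 1)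
          * ((D / (lam₂ * (lam₂ - 2) - lam' * (lam' - 2)) ^ (n + 1)) * sph lam' (hyp t)
            / (lam * (lam - 2) - lam' * (lam' - 2))) :=
        mul_le_mul_of_nonneg_left hstep (pow_nonneg (abs_nonneg _) _)
    _ = (|lam * (lam - 2) - lam₂ * (lam₂ - 2)| / (lam₂ * (lam₂ - 2) - lam' * (lam' - 2))) ^ (n + 1)
          * (D * sph lam' (hyp t) / (lam * (lam - 2) - lam' * (lam' - 2))) := by
        rw [div_pow]
        field_simp

include h1 in
/-- **THE NEUMANN SERIES CONVERGES IN THE WEIGHTED SUP-NORM ON `|μ − μ₂| < μ₂ − μ′`** (`λ, λ₂ > λ′ > 1`): the weighted remainder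
bound `(|μ − μ₂|/(μ₂ − μ′))^{n+1} D/(μ − μ′) → 0`, and at every `t > 0` the remainder is at most that bound times
`φ_{λ′}(t)`. -/
theorem tendsto_neumann_weighted {lam₂ : ℝ} (h2 : lam' < lam) (h2' : lam' < lam₂)
    {g : ℝ → ℝ} (hg : ContinuousOn g (Ioi 0))
    {M : ℝ} (hM : ∀ s ∈ Ioc (0 : ℝ) 1, |g s| ≤ M) (hM0 : 0 ≤ M)
    {ε C s₀ : ℝ} (hε : 2 - lam < ε) (hε₂ : 2 - lam₂ < ε) (hC : ∀ s, s₀ ≤ s → |g s| ≤ C * Real.exp (-ε * s))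
    {D : ℝ} (hD : ∀ s, 0 < s → |g s| ≤ D * sph lam' (hyp s))
    (hq : |lam * (lam - 2) - lam₂ * (lam₂ - 2)| < lam₂ * (lam₂ - 2) - lam' * (lam' - 2)) :
    Tendsto (fun n : ℕ => (|lam * (lam - 2) - lam₂ * (lam₂ - 2)| / (lam₂ * (lam₂ - 2) - lam' * (lam' - 2))) ^ (n + 1)
      * (D / (lam * (lam - 2) - lam' * (lam' - 2)))) atTop (𝓝 0) ∧
    ∀ n : ℕ, ∀ t, 0 < t → |greenSolI (fun t => sph lam (hyp t)) (sphDecay lam) g t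
        - ∑ k ∈ Finset.range (n + 1), (lam * (lam - 2) - lam₂ * (lam₂ - 2)) ^ k
          * (greenSolI (fun t => sph lam₂ (hyp t)) (sphDecay lam₂))^[k + 1] g t|
      ≤ ((|lam * (lam - 2) - lam₂ * (lam₂ - 2)| / (lam₂ * (lam₂ - 2) - lam' * (lam' - 2))) ^ (n + 1)
        * (D / (lam * (lam - 2) - lam' * (lam' - 2)))) * sph lam' (hyp t) := by
  have hμ₂ : 0 < lam₂ * (lam₂ - 2) - lam' * (lam' - 2) := by nlinarith
  set q := |lam * (lam - 2) - lam₂ * (lam₂ - 2)| / (lam₂ * (lam₂ - 2) - lam' * (lam' - 2)) with hq_def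
  have hq0 : 0 ≤ q := by positivity
  have hq1 : q < 1 := by rw [hq_def, div_lt_one hμ₂]; exact hq
  refine ⟨?_, fun n t ht => ?_⟩
  · have h := (tendsto_pow_atTop_nhds_zero_of_lt_one hq0 hq1).comp (tendsto_add_atTop_nat 1)
    have h' := h.mul_const (D / (lam * (lam - 2) - lam' * (lam' - 2)))
    rwa [zero_mul] at h'
  · calc |greenSolI (fun t => sph lam (hyp t)) (sphDecay lam) g t
          - ∑ k ∈ Finset.range (n + 1), (lam * (lam - 2) - lam₂ * (lam₂ - 2)) ^ k
            * (greenSolI (fun t => sph lam₂ (hyp t)) (sphDecay lam₂))^[k + 1] g t|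
        ≤ q ^ (n + 1) * (D * sph lam' (hyp t) / (lam * (lam - 2) - lam' * (lam' - 2))) :=
          abs_neumann_remainder_le_mul_sph h1 h2 h2' hg hM hM0 hε hε₂ hC hD n ht
      _ = (q ^ (n + 1) * (D / (lam * (lam - 2) - lam' * (lam' - 2)))) * sph lam' (hyp t) := by ring

end measure

end Summit.Ventures.HodgeRepro2.T5SU11ResolventSupNormWeighted
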